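import Mathlib
import Literature.Computability.Complexity.SignDegreeXor

/-!
# Algebraic placement of `P⋆ = x₀ ⊕ x₁ ⊕ x₂x₃`: rational degree `2`, immunity `1` (cell `pnp-ideate`, ROUND-21 scoping, p3)

FRONTIER range-avoidance ladder, restricted-model side of rung F-N3 — nothing here bears on `P` vs `NP`.

Applebaum–Lovett (SICOMP 2018, Def. 3, Thms 1.4/5.1/5.5) characterise ALGEBRAIC (Polynomial-Calculus-over-`F₂` / XL)
refutation and inversion attacks on random local functions by the RATIONAL DEGREE of the predicate — the least `e` with
`P·R = Q`, `deg R, deg Q ≤ e`, `R ≢ 0` — and their lower bound (via Alekhnovich–Razborov, Thm 3.8) needs the predicate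
`P ⊕ y` to be `ℓ`-IMMUNE (no non-zero consequence of degree `≤ ℓ`) with `ℓ/4 > d − c`.  This file records, as finite
kernel checks, where `P⋆` sits:
* `pstar_mul_notAnd` — the rational-degree-`2` witness `P⋆(u) · (1 ⊕ u₂) = (u₀ ⊕ u₁) · (1 ⊕ u₂)`;
* `pstar_no_affine_multiplier` — no non-zero AFFINE `R` makes `P⋆ · R` affine, so the rational degree is EXACTLY `2`
  (algebraic refutation of random `P⋆` maps à la AL Thm 1.4(1) starts only at stretch `m ≥ n^{2+ε}`);
* `pstar_fibre_immune_one` — neither fibre `P⋆⁻¹(y)` has a non-zero affine consequence (`1`-immunity), while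
  `pstar_fibre_quadratic_consequence` exhibits the degree-`2` consequence `(u₀ ⊕ u₁ ⊕ y)(1 ⊕ u₂) = 0` — so `P⋆ ⊕ y` is NOT
  `2`-immune and the Alekhnovich–Razborov / AL Thm 5.5 PC lower bound is void for `P⋆` at every stretch (`ℓ = 1 < 4(d−c)`).
Consequence for the cell's ROUND-21: a PC_F₂ / XL degree lower bound for the fibres of typed `P⋆` instances (memo T21.2) is
not covered by the literature and stays a named open problem.  Affine functions on `{0,1}⁴` are parametrised by five bits.
-/

set_option linter.dupNamespace false

open Literature.Computability.Complexity

namespace Summit.PneNP.PneNP.Theorems.PstarRationalDegree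

/-- The affine Boolean function `a₀ ⊕ a₁u₀ ⊕ a₂u₁ ⊕ a₃u₂ ⊕ a₄u₃` on `{0,1}⁴`. -/
def affine (a₀ a₁ a₂ a₃ a₄ : Bool) (u : Fin 4 → Bool) : Bool :=
  xor a₀ (xor (a₁ && u 0) (xor (a₂ && u 1) (xor (a₃ && u 2) (a₄ && u 3))))

/-- Every point of `{0,1}⁴` is the vector of its coordinates. -/
theorem eq_vec (u : Fin 4 → Bool) : u = ![u 0, u 1, u 2, u 3] := by
  funext i; fin_cases i <;> rfl

/-- **Rational degree ≤ 2**: `P⋆(u) · (1 ⊕ u₂) = (u₀ ⊕ u₁) · (1 ⊕ u₂)` (both sides of degree `2`). -/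
theorem pstar_mul_notAnd (u : Fin 4 → Bool) : (xorAndPred u && !(u 2)) = (xor (u 0) (u 1) && !(u 2)) := by
  rw [xorAndPred_apply]
  cases u 0 <;> cases u 1 <;> cases u 2 <;> cases u 3 <;> rfl

/-- Bit-level form of `pstar_no_affine_multiplier`. -/
theorem pstar_no_affine_multiplier_bits :
    ∀ a₀ a₁ a₂ a₃ a₄ b₀ b₁ b₂ b₃ b₄ : Bool,
      (∀ p q r s : Bool, (xorAndPred ![p, q, r, s] && affine a₀ a₁ a₂ a₃ a₄ ![p, q, r, s]) =
          affine b₀ b₁ b₂ b₃ b₄ ![p, q, r, s]) →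
        a₀ = false ∧ a₁ = false ∧ a₂ = false ∧ a₃ = false ∧ a₄ = false := by
  decide

/-- **Rational degree > 1**: if `R` is affine and `P⋆ · R` is affine then `R ≡ 0`.  Hence the rational degree of `P⋆`
is exactly `2`. -/
theorem pstar_no_affine_multiplier (a₀ a₁ a₂ a₃ a₄ b₀ b₁ b₂ b₃ b₄ : Bool)
    (h : ∀ u : Fin 4 → Bool, (xorAndPred u && affine a₀ a₁ a₂ a₃ a₄ u) = affine b₀ b₁ b₂ b₃ b₄ u) :
    ∀ u, affine a₀ a₁ a₂ a₃ a₄ u = false := by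
  obtain ⟨h0, h1, h2, h3, h4⟩ := pstar_no_affine_multiplier_bits a₀ a₁ a₂ a₃ a₄ b₀ b₁ b₂ b₃ b₄
    (fun p q r s => h _)
  intro u; subst h0 h1 h2 h3 h4; simp [affine]

/-- Bit-level form of `pstar_fibre_immune_one`. -/
theorem pstar_fibre_immune_one_bits :
    ∀ y a₀ a₁ a₂ a₃ a₄ : Bool,
      (∀ p q r s : Bool, xorAndPred ![p, q, r, s] = y → affine a₀ a₁ a₂ a₃ a₄ ![p, q, r, s] = false) →
        a₀ = false ∧ a₁ = false ∧ a₂ = false ∧ a₃ = false ∧ a₄ = false := by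
  decide

/-- **`1`-immunity of both fibres**: an affine function vanishing on `P⋆⁻¹(y)` vanishes identically (`y = 0, 1`).  (The
fibres have `8` points each but are not hyperplanes, `P⋆` having degree `2`.) -/
theorem pstar_fibre_immune_one (y a₀ a₁ a₂ a₃ a₄ : Bool)
    (h : ∀ u : Fin 4 → Bool, xorAndPred u = y → affine a₀ a₁ a₂ a₃ a₄ u = false) :
    ∀ u, affine a₀ a₁ a₂ a₃ a₄ u = false := by
  obtain ⟨h0, h1, h2, h3, h4⟩ := pstar_fibre_immune_one_bits y a₀ a₁ a₂ a₃ a₄ (fun p q r s => h _)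
  intro u; subst h0 h1 h2 h3 h4; simp [affine]

/-- **Not `2`-immune**: the degree-`2` polynomial `(u₀ ⊕ u₁ ⊕ y)·(1 ⊕ u₂)` vanishes on the fibre `P⋆⁻¹(y)` ("if the
AND-input `u₂` is `0` then the XOR part equals `y`") and is not identically zero. -/
theorem pstar_fibre_quadratic_consequence (y : Bool) (u : Fin 4 → Bool) (hu : xorAndPred u = y) :
    (xor (xor (u 0) (u 1)) y && !(u 2)) = false := by
  rw [xorAndPred_apply] at hu
  revert hu
  cases u 0 <;> cases u 1 <;> cases u 2 <;> cases u 3 <;> cases y <;> decide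

/-- The degree-`2` consequence is non-trivial: it does not vanish at `u = (1 ⊕ y, 0, 0, 0)`. -/
theorem pstar_fibre_quadratic_consequence_nontrivial (y : Bool) :
    (xor (xor (!y) false) y && !false) = true := by
  cases y <;> rfl

end Summit.PneNP.PneNP.Theorems.PstarRationalDegree
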